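import Mathlib
import Literature.Dynamics.Billiards.URegularState
import HarnessLib

/-!
# Teeth and blind spots of the u-Gibbs predicates (`IsSubordinate`, `HasACCondMeasures`, `IsUGibbsOfDim`)

Topic `Literature/Dynamics/Billiards`; companion to `URegularState` (D2 of route UGibbsSRBRigidity). Elementary structural
lemmas about Ledrappier–Young's "absolutely continuous conditional measures on unstable plaques" as rendered in
`URegularState`, recorded because they decide how statements built on the hard-ball predicate
`HardSphereFlow.IsUGibbs` behave (finite-`N` sanity item FiniteNSanity, 2026-08-16):

1. **Plaque membership only sees the backward orbit** (`mem_unstableSet_iff_of_backward_eq`,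
   `mem_localUnstableSet_iff_of_backward_eq`, hard-ball form
   `HardSphereFlow.mem_localUnstableSet_iff_of_backward_eq`): two points with the same backward orbit
   `t ≤ 0 ↦ T t y` lie in the same plaques `localUnstableSet T δ z` of every point and every size — the position of the
   point itself never enters (the `t = 0` test reads `T 0 y`). For a hard-sphere flow whose junk branch off `Φ.good`
   copies orbits of good points (`Literature.Analysis.FluidPDE.HardSphereFlow` leaves the junk free), every plaque of a
   good point acquires the corresponding non-good points: the predicates read the junk.
2. **The subordination clash** (`PlaqueFamily.subordinate_clash`, `PlaqueFamily.not_isSubordinate_of_clash`): the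
   pointwise obstruction to the existence of subordinate partitions (Ledrappier–Young Def. 1.4.1) when plaques of nearby
   points overlap without being nested; with adversarial junk it makes `HasACCondMeasures` vacuous.
3. **Teeth of the point partition** (`pointPartition`, `PlaqueFamily.not_hasACCondMeasures_of_isolated`,
   `not_isUGibbsOfDim_of_isolated`, `HardSphereFlow.not_isUGibbs_of_isolated`): if `μ`-a.e. point is ISOLATED in its
   plaque and leaf measures have no atoms, the point partition is subordinate with Dirac conditional measures, so
   `HasACCondMeasures` / `IsUGibbsOfDim` FAIL for every `μ ≠ 0`. For hard balls with the sup-product metric on positions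
   and velocities, velocity jumps at collisions desynchronise distinct points of an unstable curve and make typical
   plaques isolated (indeed `unstableSet Φ.flow z ∩ Φ.good = {z}` for Liouville-a.e. `z` of a natural flow), so this is
   the lemma by which the rendering with velocities in the metric loses the Liouville law itself.

Nothing here is specific to billiards except §4; no dynamics is proved (isolation / orbit-copying are hypotheses).

## References

* F. Ledrappier, L.-S. Young, *The metric entropy of diffeomorphisms I*, Ann. Math. 122 (1985), (1.2)–(1.3) p. 512,
  Def. 1.4.1–1.4.2 p. 513 [LedrappierYoung1985].
* V. A. Rokhlin, *On the fundamental ideas of measure theory* (1949) (measurable partitions, point partition).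
-/

noncomputable section

open MeasureTheory Set Filter Metric
open scoped ENNReal Topology

namespace Literature.Dynamics.Billiards

/-! ## 1. Plaque membership only sees the backward orbit -/

section Leak

variable {α : Type*} [PseudoMetricSpace α] {T : ℝ → α → α}

/-- Two points with the same backward `T`-orbit (times `t ≤ 0`, including `t = 0`) lie in the same unstable sets.
[folklore] -/
theorem mem_unstableSet_iff_of_backward_eq {y p : α} (h : ∀ t : ℝ, t ≤ 0 → T t y = T t p) (z : α) :
    y ∈ unstableSet T z ↔ p ∈ unstableSet T z := by
  have key : ∀ t : ℝ, 0 ≤ t → T (-t) y = T (-t) p := fun t ht => h (-t) (neg_nonpos.2 ht)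
  simp only [mem_unstableSet_iff]
  constructor
  · rintro ⟨r, hr, hev⟩
    refine ⟨r, hr, ?_⟩
    filter_upwards [hev, eventually_ge_atTop 0] with t ht ht0
    rwa [← key t ht0]
  · rintro ⟨r, hr, hev⟩
    refine ⟨r, hr, ?_⟩
    filter_upwards [hev, eventually_ge_atTop 0] with t ht ht0
    rwa [key t ht0]

/-- **Plaque membership only sees the backward orbit.** Two points with the same backward orbit `t ≤ 0 ↦ T t ·` lie
in the same plaques `localUnstableSet T δ z`, for every size `δ` and base point `z`; the position of the point itself
never enters (the `t = 0` test reads `dist (T 0 y) (T 0 z) ≤ δ`). [folklore] -/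
theorem mem_localUnstableSet_iff_of_backward_eq {y p : α} (h : ∀ t : ℝ, t ≤ 0 → T t y = T t p) (δ : ℝ)
    (z : α) : y ∈ localUnstableSet T δ z ↔ p ∈ localUnstableSet T δ z := by
  have key : ∀ t : ℝ, 0 ≤ t → T (-t) y = T (-t) p := fun t ht => h (-t) (neg_nonpos.2 ht)
  simp only [mem_localUnstableSet_iff, mem_unstableSet_iff_of_backward_eq h z]
  constructor
  · rintro ⟨hu, hloc⟩
    exact ⟨hu, fun t ht => key t ht ▸ hloc t ht⟩
  · rintro ⟨hu, hloc⟩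
    exact ⟨hu, fun t ht => (key t ht).symm ▸ hloc t ht⟩

end Leak

section LeakHardBalls

open Literature.Analysis.FluidPDE

variable {d : Type*} [Fintype d] {X : Type*} [MeasureSpace X] [PseudoMetricSpace X] {N : ℕ} {ε : ℝ}
  {G : Geometry d X}

/-- **Hard balls: the unstable plaques read the junk of the flow.** If the orbit of `y` under `Φ.flow` coincides for
all times `t ≤ 0` with that of `p` — e.g. `y ∉ Φ.good` and the junk branch of `Φ` copies the orbit of the good point
`p` — then `y` lies in exactly the local unstable sets `p` lies in, wherever `y` sits in phase space. (Dot-notation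
extension of `Literature.Analysis.FluidPDE.HardSphereFlow`, declared from this directory on purpose.) [folklore] -/
theorem _root_.Literature.Analysis.FluidPDE.HardSphereFlow.mem_localUnstableSet_iff_of_backward_eq
    (Φ : HardSphereFlow G ε N) {y p : Config N d X} (h : ∀ t : ℝ, t ≤ 0 → Φ.flow t y = Φ.flow t p) (δ : ℝ)
    (z : Config N d X) : y ∈ Φ.localUnstableSet δ z ↔ p ∈ Φ.localUnstableSet δ z :=
  Literature.Dynamics.Billiards.mem_localUnstableSet_iff_of_backward_eq h δ z

end LeakHardBalls

/-! ## 2. The subordination clash -/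

section Clash

variable {α : Type*} [MeasurableSpace α]

/-- **Subordination clash.** Let `ξ` be a measurable partition and `W` a plaque family. If `U ∩ W(x₁) ⊆ ξ(x₁)`
(condition (2) of Ledrappier–Young's Def. 1.4.1 at `x₁`), `ξ(x₂) ⊆ W(x₂)` (condition (1) at `x₂`), `x₂ ∈ U ∩ W(x₁)`,
and some `y ∈ U ∩ W(x₁)` is NOT in `W(x₂)`, contradiction: `x₂ ∈ ξ(x₁)` forces `ξ(x₂) = ξ(x₁) ∋ y`, so `y ∈ W(x₂)`.
[cite: LedrappierYoung1985, Def. 1.4.1 p. 513] -/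
theorem PlaqueFamily.subordinate_clash (L : PlaqueFamily α) (ξ : MeasurablePartition α) {x₁ x₂ y : α}
    {U : Set α} (h₁ : U ∩ L.plaque x₁ ⊆ ξ.atom x₁) (h₂ : ξ.atom x₂ ⊆ L.plaque x₂)
    (hx₂ : x₂ ∈ U ∩ L.plaque x₁) (hy : y ∈ U ∩ L.plaque x₁) (hy' : y ∉ L.plaque x₂) : False := by
  have heq : ξ.atom x₂ = ξ.atom x₁ := @measurableAtom_eq_of_mem α ξ.sigma x₂ x₁ (h₁ hx₂)
  exact hy' (h₂ (heq ▸ h₁ hy))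

/-- **No subordinate partition under the clash configuration**: if it is NOT the case that for `μ`-a.e. `x₁` some
neighbourhood `U` of `x₁` is free of the configuration "`x₂ ∈ U ∩ W(x₁)` with `ξ(x₂) ⊆ W(x₂)` and
`y ∈ (U ∩ W(x₁)) \ W(x₂)`", then `ξ` is not subordinate to `W` for `μ`. [cite: LedrappierYoung1985, Def. 1.4.1 p. 513] -/
theorem PlaqueFamily.not_isSubordinate_of_clash [TopologicalSpace α] (L : PlaqueFamily α) (μ : Measure α)
    (ξ : MeasurablePartition α)
    (hclash : ¬ ∀ᵐ x₁ ∂μ, ¬ ∀ U ∈ 𝓝 x₁, ∃ x₂ ∈ U ∩ L.plaque x₁, ξ.atom x₂ ⊆ L.plaque x₂ ∧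
      ∃ y ∈ U ∩ L.plaque x₁, y ∉ L.plaque x₂) :
    ¬ L.IsSubordinate μ ξ := by
  intro hsub
  apply hclash
  filter_upwards [hsub] with x₁ hx₁ hall
  obtain ⟨U, hU, hUsub⟩ := hx₁.2
  obtain ⟨x₂, hx₂, h₂, y, hy, hy'⟩ := hall U hU
  exact L.subordinate_clash ξ hUsub h₂ hx₂ hy hy'

end Clash

/-! ## 3. Teeth of the point partition -/

section Teeth

variable {α : Type*} [MeasurableSpace α]

/-- The **point partition** of a standard Borel space in Rokhlin's sense: σ-algebra of saturated sets = all Borel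
sets (countably generated), atoms = singletons. [folklore] -/
def pointPartition (α : Type*) [MeasurableSpace α] [StandardBorelSpace α] : MeasurablePartition α where
  sigma := ‹MeasurableSpace α›
  sigma_le := le_rfl
  countablyGenerated := inferInstance

/-- Atoms of the point partition are singletons. [folklore] -/
@[simp] theorem pointPartition_atom [StandardBorelSpace α] (x : α) : (pointPartition α).atom x = {x} :=
  measurableAtom_of_measurableSingletonClass x

/-- **Isolated plaques are fatal for absolutely continuous conditional measures.** If `μ ≠ 0`, `μ`-a.e. point lies
in its plaque and is ISOLATED in it (`U ∩ W(x) ⊆ {x}` for some neighbourhood `U`), and the leaf measures have no atom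
at the base point, then `μ` does not have absolutely continuous conditional measures on the plaques: the point
partition is subordinate (Def. 1.4.1) and its conditional measures are Dirac masses (`ae_condMeasure_atom_eq_one`),
which charge the leaf-null singleton. [cite: LedrappierYoung1985, Def. 1.4.2 p. 513] -/
theorem PlaqueFamily.not_hasACCondMeasures_of_isolated [TopologicalSpace α] [StandardBorelSpace α]
    (L : PlaqueFamily α) (μ : Measure α) [IsFiniteMeasure μ] (hμ : μ ≠ 0) (hself : ∀ᵐ x ∂μ, x ∈ L.plaque x)
    (hiso : ∀ᵐ x ∂μ, ∃ U ∈ 𝓝 x, U ∩ L.plaque x ⊆ {x}) (hleaf : ∀ᵐ x ∂μ, L.leafMeasure x {x} = 0) :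
    ¬ L.HasACCondMeasures μ := by
  intro hac
  have hsub : L.IsSubordinate μ (pointPartition α) := by
    filter_upwards [hself, hiso] with x hx hU
    rw [pointPartition_atom]
    exact ⟨singleton_subset_iff.2 hx, hU⟩
  have hall : ∀ᵐ x ∂μ, False := by
    filter_upwards [hac _ hsub, (pointPartition α).ae_condMeasure_atom_eq_one μ, hleaf] with x hx hatom hleafx
    rw [pointPartition_atom] at hatom
    have h0 : (pointPartition α).condMeasure μ x {x} = 0 := hx hleafx
    rw [h0] at hatom
    exact zero_ne_one hatom
  rw [ae_iff] at hall
  simp only [not_false_eq_true, setOf_true] at hall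
  exact hμ (Measure.measure_univ_eq_zero.1 hall)

end Teeth

section TeethFlow

variable {α : Type*} [MetricSpace α] [MeasurableSpace α] [BorelSpace α] [StandardBorelSpace α]
  {T : ℝ → α → α} {k : ℝ}

/-- **Isolated unstable sets are fatal for `IsUGibbsOfDim`** (positive leaf dimension): if for ONE measurable size
function `δ > 0`, `μ`-a.e. point is isolated in its local unstable set `W^u_{δ(x)}(x)`, then the finite measure
`μ ≠ 0` is not u-Gibbs of dimension `k > 0` (point partition subordinate, Dirac conditional measures, while `μH[k]`
has no atoms). [cite: LedrappierYoung1985, Def. 1.4.2 p. 513] -/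
theorem not_isUGibbsOfDim_of_isolated (μ : Measure α) [IsFiniteMeasure μ] (hμ : μ ≠ 0) (hk : 0 < k)
    (δ : α → ℝ) (hδm : Measurable δ) (hδ : ∀ z, 0 < δ z)
    (hiso : ∀ᵐ x ∂μ, ∃ U ∈ 𝓝 x, U ∩ localUnstableSet T (δ x) x ⊆ {x}) : ¬ IsUGibbsOfDim T k μ := by
  intro hU
  refine (unstablePlaques T δ k).not_hasACCondMeasures_of_isolated μ hμ ?_ ?_ ?_ (hU δ hδm hδ)
  · exact Eventually.of_forall fun x => self_mem_localUnstableSet T (hδ x).le x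
  · simpa only [unstablePlaques_plaque] using hiso
  · refine Eventually.of_forall fun x => ?_
    simp only [unstablePlaques_leafMeasure]
    haveI : NullSingletonClass (μH[k] : Measure α) := Measure.nullSingletonClass_hausdorff _ hk
    exact measure_singleton x

end TeethFlow

/-! ## 4. Hard balls -/

section TeethHardBalls

open Literature.Analysis.FluidPDE

variable {d : Type*} [Fintype d] {N : ℕ} {ε : ℝ}

/-- **Isolated unstable sets are fatal for `HardSphereFlow.IsUGibbs`.** For a hard-ball flow on `𝕋^d` with positive
unstable dimension `dN - d - 1`, a finite law `μ ≠ 0` such that, for some measurable size function `δ > 0`, `μ`-a.e.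
configuration is isolated in its local unstable set is NOT u-Gibbs. With the sup-product metric on positions AND
velocities this hypothesis is what velocity jumps at collisions produce for a natural flow (distinct points of an
unstable curve un-collide at distinct instants, so `dist ≤ δ` at all backward times fails in the window), so the
corollary exhibits the blind spot of the rendering rather than a property of hard balls. [cite: LedrappierYoung1985, Def. 1.4.2 p. 513] -/
theorem _root_.Literature.Analysis.FluidPDE.HardSphereFlow.not_isUGibbs_of_isolated
    (Φ : HardSphereFlow (Torus.geometry d) ε N) (μ : Measure (Config N d (UnitAddTorus d))) [IsFiniteMeasure μ]
    (hμ : μ ≠ 0) (hk : 0 < hardBallUnstableDim (Fintype.card d) N) (δ : Config N d (UnitAddTorus d) → ℝ)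
    (hδm : Measurable δ) (hδ : ∀ z, 0 < δ z)
    (hiso : ∀ᵐ x ∂μ, ∃ U ∈ 𝓝 x, U ∩ Φ.localUnstableSet (δ x) x ⊆ {x}) : ¬ Φ.IsUGibbs μ :=
  not_isUGibbsOfDim_of_isolated μ hμ (by exact_mod_cast hk) δ hδm hδ
    (by simpa only [HardSphereFlow.localUnstableSet_eq] using hiso)

end TeethHardBalls

end Literature.Dynamics.Billiards

end
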